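import Literature.Probability.Percolation.ArmSeparation
import Literature.Probability.Percolation.ArmEventsAPriori
import HarnessLib

/-!
# Gluing well-separated two-arm events across scales (Nolin 2008, Prop. 12)

Topic: Probability / Percolation; family `crit-perc` (critical site percolation `P_{1/2}` on the
triangular lattice `𝕋 = triGraph`; hexagonal annuli `Λ_N ∖ Λ_n`, `Λ_n = triBall n`,
`|·|_𝕋 = triNorm`). Third bottom-up brick for the discharge of the named fact
`Literature.Probability.Percolation.Nolin2008_twoArm_quasiMult` (`ArmExponentsTwoArm.lean`;
Nolin, *Near-critical percolation in two dimensions*, EJP 13 (2008), Prop. 17 [arXiv 0711.4948: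
Prop. 16]) from the arm-separation theorem `Literature.Probability.Percolation.Nolin2008_twoArm_separation`
(`ArmSeparation.lean`; Nolin Thm. 11 [arXiv Thm. 10]), hence of
`Literature.Probability.Percolation.twoArm_exponent` (Smirnov–Werner 2001) given the scaling-limit
input. This file is the DETERMINISTIC half of Nolin's gluing argument (proof of Prop. 12
[arXiv Prop. 11]: "The proof relies of gluing arguments based on RSW constructions"; Kesten 1987,
extension of arms through fences); the probabilistic half is `ArmSeparationProofs.lean`.
Everything here is proved; the file introduces three definitions (`sepGlue`, `sepGlueFinset`,
`sepSupportSet`).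

## Contents

* `PathIn.exists_arm_of_triNorm_le`, `mem_armEvent_one_of_pathIn` — trimming an open path from
  `Λ_r` to the outside of `Λ̊_R` to an arm of `armEvent ![true] r R` (first visit to
  `{|·|_𝕋 ≥ R}`, last visit to `Λ_r` before it; `|·|_𝕋` is `1`-Lipschitz along edges).
* `negFlip_eq_compl_relabel`, `mem_armEvent_false_of_negFlip` — `negFlip` (`ArmSeparation.lean`)
  is the map `ω ↦ (relabel (-·) ω)ᶜ` of `ArmEventsAPriori.lean`; it turns open arms into closed
  arms.
* `PathIn.relay` — two open paths crossing a common box in transverse directions join their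
  starting points (Kesten 1982, §2.2, via the tree's `exists_mem_of_cross` /
  `PathIn.tri_crossings_meet` and tight supports `PathIn.exists_support`).
* `sepGlue q` — **the gluing event at scale `q`**: `69` open box crossings in the right half of
  the annulus `{64q < |·|_𝕋 < 512(q+1)}` (33 thin boxes over the rows of the outer free spaces at
  scale `64q`, a tube, a long box, a tube, 33 boxes over the rows of the inner free spaces at
  scale `512(q+1)`); the scales `64q`, `512(q+1)` make all the integer parts `N/4`, `N/8`, `N/64`
  of the fences of `ArmSeparation.lean` exact. (The unproved `sepGlueEvent` of
  `ArmSeparation.lean`, written for consecutive scales `m`, `8m + O(1)`, is not used.)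
* `sepOpenArm_inter_sepGlue_subset` — **gluing**: a fenced open arm across `Λ_{64q} ∖ Λ_{n₁}`,
  `sepGlue q` and a fenced open arm across `Λ_{n₃} ∖ Λ_{512(q+1)}` contain an open arm across
  `Λ_{n₃} ∖ Λ_{n₁}`; `sepTwoArm_inter_sepGlue_subset` — the same with the mirrored closed pieces
  gives `armEvent ![true, false] n₁ n₃`.
* `sepSupportSet n N` (the sites a fenced arm event depends on: the annulus widened by the free
  spaces and attaching balls, the latter in `{x₀ > 0}`), `sepGlueFinset q` (the sites of the
  gluing boxes) and their geometry (`sepInnerFence_subset_sepSupportSet`,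
  `sepOuterFence_subset_sepSupportSet`, `sepJoinRegion_subset_sepSupportSet`,
  `sepGlueFinset_subset`).

## Faithfulness

Nolin glues `Ã̃`-events of consecutive annuli `S_{n₁,n₂/4}`, `S_{n₂,n₃}` through RSW
constructions in their free spaces (Prop. 12, items "extendability" and
"quasi-multiplicativity"; Fig. 6 of the arXiv text); the shapes are rhombi there and hexagons
here (as everywhere in this library, see `ArmExponentsTwoArm.lean`), the landing areas are the
middle halves of the right sides (open arm) and left sides (closed arm), and the finitely many
boxes are listed explicitly. The number (`69`) and aspect ratios (`≤ 98`) of the boxes only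
affect constants.

## References

* P. Nolin, *Near-critical percolation in two dimensions*, Electron. J. Probab. 13 (2008),
  1562–1623, §4.2 (free spaces), §4.3 Prop. 12 and its proof [arXiv 0711.4948: Prop. 11].
  [Nolin2008]
* H. Kesten, *Scaling relations for 2D-percolation*, Comm. Math. Phys. 109 (1987), 109–156
  (fences; cited after Nolin 2008, §4.2). [Kesten1987]
* H. Kesten, *Percolation theory for mathematicians* (1982), §2.2 (crossing paths of a box meet).
  [KestenPTM1982]

Mathlib search: no percolation, arm events or RSW theory in Mathlib (`rg -i "percolation|arm
event|Russo-Seymour"`: nothing relevant); used from Mathlib: `Relation.ReflTransGen` (through the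
tree's `PathIn`), `Int.mul_ediv_add_emod`, `Finset.biUnion`. Tree: `ArmSeparation.lean`
(`sepOpenArm`, `sepTwoArm`, `negFlip`, fences, landing zones), `ArmEventsAPriori.lean`
(`mem_armEvent_one_iff_exists_pathIn`, `mem_armEvent_one_of_relabel_neg_compl`,
`exists_mem_of_cross`, `triNorm` arithmetic), `ArmEventsProofs.lean`
(`triNorm_le_triNorm_add_one_of_adj`), `ArmEventsStructure.lean` (`armEvent_two_eq_inter`),
`TriRSWChaining.lean` (`triHCross`, `triVCross`, `triStrip`, `triStripFinset`,
`PathIn.exists_support`), `SitePaths.lean` (`PathIn.exit`, `PathIn.last_exit_or`).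
-/

noncomputable section

open Set

namespace Literature.Probability.Percolation

open LatticeModels

/-! ### Trimming an open path to an arm -/

/-- **Trimming.** An open `𝕋`-path from a site of `Λ_r` to a site outside `Λ̊_R` (`r ≤ R`)
contains an open arm of the closed annulus `{r ≤ |·|_𝕋 ≤ R}` from `∂Λ_r` to `∂Λ_R`: cut the path
at its first visit to `{|·|_𝕋 ≥ R}` and, before that, at its last visit to `Λ_r` (the graph norm
changes by at most one along an edge). [folklore] -/
theorem PathIn.exists_arm_of_triNorm_le {ω : Set (Site 2)} {u v : Site 2} {r R : ℕ}
    (h : PathIn triGraph ω u v) (hu : triNorm u ≤ r) (hv : (R : ℤ) ≤ triNorm v) (hrR : r ≤ R) :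
    ∃ x y : Site 2, triNorm x = r ∧ triNorm y = R ∧
      PathIn triGraph ({w : Site 2 | (r : ℤ) ≤ triNorm w ∧ triNorm w ≤ R} ∩ ω) x y := by
  have hrR' : (r : ℤ) ≤ R := by exact_mod_cast hrR
  -- first visit to `{|·| ≥ R}`
  obtain ⟨b, hbR, hub⟩ : ∃ b : Site 2, triNorm b = R ∧
      PathIn triGraph ({w : Site 2 | triNorm w ≤ R} ∩ ω) u b := by
    by_cases huR : triNorm u < R
    · obtain ⟨a, b, ha, hb, hbω, hab, hua⟩ :=
        h.exit (R := {w : Site 2 | triNorm w < R}) huR (fun hv' => absurd hv (not_le.2 hv'))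
      simp only [mem_setOf_eq, not_lt] at ha hb
      have hb' : triNorm b ≤ R := (triNorm_le_triNorm_add_one_of_adj hab).trans (by omega)
      have hua' : PathIn triGraph ({w : Site 2 | triNorm w ≤ R} ∩ ω) u a :=
        hua.mono fun w hw => ⟨le_of_lt (α := ℤ) hw.1, hw.2⟩
      exact ⟨b, le_antisymm hb' hb, hua'.tail hab ⟨hb', hbω⟩⟩
    · have huR' : triNorm u = R := by omega
      have huA : u ∈ {w : Site 2 | triNorm w ≤ R} ∩ ω := ⟨by simp [huR'], h.left_mem⟩
      exact ⟨u, huR', PathIn.refl huA⟩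
  -- last visit to `Λ_r`
  rcases hub.last_exit_or (C := {w : Site 2 | triNorm w ≤ r}) hu with hbr | ⟨a, b', ha, haA, hb', hab', hp⟩
  · simp only [mem_setOf_eq] at hbr
    have hbA : b ∈ {w : Site 2 | (r : ℤ) ≤ triNorm w ∧ triNorm w ≤ R} ∩ ω :=
      ⟨⟨by omega, by omega⟩, hub.right_mem.2⟩
    exact ⟨b, b, by omega, hbR, PathIn.refl hbA⟩
  · simp only [mem_setOf_eq, not_le] at ha hb'
    have ha' : (r : ℤ) ≤ triNorm a := by
      have := triNorm_le_triNorm_add_one_of_adj hab'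
      omega
    have hbA := hp.left_mem
    simp only [mem_sdiff, mem_inter_iff, mem_setOf_eq, not_le] at hbA
    have haT : a ∈ {w : Site 2 | (r : ℤ) ≤ triNorm w ∧ triNorm w ≤ R} ∩ ω := ⟨⟨ha', haA.1⟩, haA.2⟩
    have hbT : b' ∈ {w : Site 2 | (r : ℤ) ≤ triNorm w ∧ triNorm w ≤ R} ∩ ω :=
      ⟨⟨hbA.2.le, hbA.1.1⟩, hbA.1.2⟩
    have hp' : PathIn triGraph ({w : Site 2 | (r : ℤ) ≤ triNorm w ∧ triNorm w ≤ R} ∩ ω) b' b := by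
      refine hp.mono ?_
      rintro w ⟨⟨hw1, hw2⟩, hw3⟩
      simp only [mem_setOf_eq, not_le] at hw3
      exact ⟨⟨hw3.le, hw1⟩, hw2⟩
    exact ⟨a, b, le_antisymm ha ha', hbR, (PathIn.of_adj haT hbT hab').trans hp'⟩

/-- An open `𝕋`-path from a site of `Λ_r` to a site outside `Λ̊_R` (`r ≤ R`) realises the open
one-arm event `armEvent ![true] r R`. [folklore] -/
theorem mem_armEvent_one_of_pathIn {ω : SiteConfig (Site 2)} {u v : Site 2} {r R : ℕ}
    (h : PathIn triGraph ω u v) (hu : triNorm u ≤ r) (hv : (R : ℤ) ≤ triNorm v) (hrR : r ≤ R) :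
    ω ∈ armEvent ![true] r R := by
  obtain ⟨x, y, hx, hy, hp⟩ := h.exists_arm_of_triNorm_le hu hv hrR
  rw [mem_armEvent_one_iff_exists_pathIn hrR]
  refine ⟨x, mem_triSphere_iff.2 hx, y, mem_triSphere_iff.2 hy, hp.mono ?_⟩
  rintro w ⟨hw1, hw2⟩
  exact ⟨hw1, by simpa using hw2⟩

/-! ### The symmetry `negFlip` -/

/-- `negFlip` is "central symmetry composed with colour exchange" in the form used in
`ArmEventsAPriori.lean`. [folklore] -/
theorem negFlip_eq_compl_relabel (ω : SiteConfig (Site 2)) :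
    negFlip ω = ((SiteConfig.relabel (Equiv.neg (Site 2))) ω)ᶜ := by
  ext x
  simp

/-- `negFlip` as a function is the map `ω ↦ (relabel (-·) ω)ᶜ`. [folklore] -/
theorem negFlip_eq : (negFlip : SiteConfig (Site 2) → SiteConfig (Site 2)) =
    fun ω => ((SiteConfig.relabel (Equiv.neg (Site 2))) ω)ᶜ :=
  funext negFlip_eq_compl_relabel

/-- The mirror image under `negFlip` of an open arm is a closed arm. [folklore] -/
theorem mem_armEvent_false_of_negFlip {r R : ℕ} (hrR : r ≤ R) {ω : SiteConfig (Site 2)}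
    (h : negFlip ω ∈ armEvent ![true] r R) : ω ∈ armEvent ![false] r R := by
  rw [negFlip_eq_compl_relabel] at h
  exact mem_armEvent_one_of_relabel_neg_compl (c := true) hrR h


/-! ### Crossings that meet, and the relay lemma -/

/-- **Relay lemma.** If an open path inside `A` crosses the box `[L, R] × [B, T]` horizontally
(it starts left of the column `L`, ends right of the column `R`, and inside these columns `A`
lies between the rows `B` and `T`) and an open path inside `A'` crosses the same box vertically,
then the two starting points are joined by an open path inside `A ∪ A'` (the two crossings share
a site: Kesten 1982, §2.2; `exists_mem_of_cross`). [folklore] -/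
theorem PathIn.relay {A A' : Set (Site 2)} {ω : Set (Site 2)} {p q p' q' : Site 2}
    {L R B T : ℤ} (hLR : L ≤ R) (hBT : B ≤ T)
    (hP : PathIn triGraph (A ∩ ω) p q) (hp : p 0 ≤ L) (hq : R ≤ q 0)
    (hA : ∀ z ∈ A, L ≤ z 0 → z 0 ≤ R → B ≤ z 1 ∧ z 1 ≤ T)
    (hQ : PathIn triGraph (A' ∩ ω) p' q') (hp' : p' 1 ≤ B) (hq' : T ≤ q' 1)
    (hA' : ∀ z ∈ A', B ≤ z 1 → z 1 ≤ T → L ≤ z 0 ∧ z 0 ≤ R) :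
    PathIn triGraph ((A ∪ A') ∩ ω) p p' := by
  obtain ⟨S, hS, hPS, hSall⟩ := hP.exists_support
  obtain ⟨S', hS', hQS, hS'all⟩ := hQ.exists_support
  obtain ⟨z, hz, hz'⟩ := exists_mem_of_cross hLR hBT hPS hp hq
    (fun z hz h1 h2 => hA z (hS hz).1 h1 h2) hQS hp' hq' (fun z hz h1 h2 => hA' z (hS' hz).1 h1 h2)
  exact ((hSall z hz).mono (hS.trans (inter_subset_inter_left _ subset_union_left))).trans
    ((hS'all z hz').symm.mono (hS'.trans (inter_subset_inter_left _ subset_union_right)))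

/-- **Slabs.** An interval `[t - s, t + s]` with `-48 s ≤ t ≤ -16 s` contains one of the `33`
grid slabs `[(k - 48) s, (k - 47) s]`, `k < 33` (take `k - 48 = ⌊t / s⌋`). [folklore] -/
theorem exists_glueSlab {s : ℕ} (hs : 1 ≤ s) {t : ℤ} (h1 : -(48 * (s : ℤ)) ≤ t) (h2 : t ≤ -(16 * (s : ℤ))) :
    ∃ k : ℕ, k < 33 ∧ t - s ≤ (-48 + (k : ℤ)) * s ∧ (-48 + (k : ℤ)) * s + s ≤ t + s := by
  have hs0 : (0 : ℤ) < s := by exact_mod_cast hs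
  set y : ℤ := t / s with hy
  have hdiv : (s : ℤ) * y + t % s = t := Int.mul_ediv_add_emod t s
  have hr0 : 0 ≤ t % s := Int.emod_nonneg t hs0.ne'
  have hr1 : t % s < s := Int.emod_lt_of_pos t hs0
  have hy1 : -48 ≤ y := by
    have : (s : ℤ) * (-48) < s * (y + 1) := by nlinarith
    have := lt_of_mul_lt_mul_left this hs0.le
    omega
  have hy2 : y ≤ -16 := by
    have : (s : ℤ) * y ≤ s * (-16) := by nlinarith
    exact le_of_mul_le_mul_left this hs0
  refine ⟨(y + 48).toNat, by omega, ?_, ?_⟩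
  · have : (-48 + ((y + 48).toNat : ℤ)) = y := by omega
    rw [this]; nlinarith
  · have : (-48 + ((y + 48).toNat : ℤ)) = y := by omega
    rw [this]; nlinarith

/-! ### The gluing event -/

/-- **The gluing event at scale `q`** (all crossings open, all boxes in the right half-plane
between the hexagons `∂Λ_{64q}` and `∂Λ_{512(q+1)}`): with `Q = q + 1`,
* the `33` thin boxes `[64q+1, 80q+1] × [(k-48) q, (k-47) q]`, `k < 33`, crossed horizontally
  (they cover the rows `[-49q, -15q]` met by the outer free spaces `[64q+1, 72q] × [t-q, t+q]`,
  `-48q ≤ t ≤ -16q`, of a fenced arm landing on the right side of `∂Λ_{64q}`);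
* the tube `[72q+1, 80q+1] × [-392Q, 0]` crossed vertically;
* the box `[72q+1, 440Q-1] × [-392Q, 0]` crossed horizontally;
* the tube `[432Q-1, 440Q-1] × [-392Q, 0]` crossed vertically;
* the `33` boxes `[432Q-1, 512Q-1] × [8Q(k-48), 8Q(k-47)]`, `k < 33`, crossed horizontally (they
  cover the rows met by the inner free spaces `[448Q, 512Q-1] × [t'-8Q, t'+8Q]`,
  `-384Q ≤ t' ≤ -128Q`, of a fenced arm landing on the right side of `∂Λ_{512Q}` from outside).
Consecutive pieces cross a common box in transverse directions, hence meet. This is the finite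
RSW gluing construction of Nolin 2008, proof of Prop. 12 [arXiv 0711.4948: Prop. 11] ("gluing
arguments based on RSW constructions"; Kesten 1987, extension of arms through fences), written
for the hexagonal annuli and the fences of `ArmSeparation.lean` at the exactly divisible scales
`64q`, `512(q+1)`. [cite: Nolin2008, §4.3 Prop. 12 (proof) (arXiv 0711.4948: Prop. 11)] -/
def sepGlue (q : ℕ) : Set (SiteConfig (Site 2)) :=
  (⋂ k ∈ Finset.range 33, triHCross (64 * (q : ℤ) + 1) ((-48 + (k : ℤ)) * q) (16 * q) q) ∩
    triVCross (72 * (q : ℤ) + 1) (-(392 * ((q : ℤ) + 1))) (8 * q) (392 * (q + 1)) ∩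
    triHCross (72 * (q : ℤ) + 1) (-(392 * ((q : ℤ) + 1))) (368 * q + 438) (392 * (q + 1)) ∩
    triVCross (432 * ((q : ℤ) + 1) - 1) (-(392 * ((q : ℤ) + 1))) (8 * (q + 1)) (392 * (q + 1)) ∩
    (⋂ k ∈ Finset.range 33, triHCross (432 * ((q : ℤ) + 1) - 1) ((-48 + (k : ℤ)) * (8 * ((q : ℤ) + 1)))
      (80 * (q + 1)) (8 * (q + 1)))

/-! ### The deterministic gluing -/

/-- A site of an inner free space at scale `n` lies in `Λ_n`. [cite: Nolin2008, §4.2, free spaces on the internal boundary (arXiv 0711.4948: Def. 6–7)] -/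
theorem triNorm_le_of_mem_sepInnerFence {n : ℕ} {z' u : Site 2} (hz' : z' ∈ sepLanding n)
    (hu : u ∈ sepInnerFence n z') : triNorm u ≤ n := by
  rw [mem_sepLanding] at hz'
  rw [mem_sepInnerFence] at hu
  rw [triNorm_le_iff_lin]
  omega

/-- A site of an outer free space at scale `N` lies outside `Λ_N`. [cite: Nolin2008, §4.2, free spaces (arXiv 0711.4948: Def. 6)] -/
theorem lt_triNorm_of_mem_sepOuterFence {N : ℕ} {z u : Site 2} (hu : u ∈ sepOuterFence N z) :
    (N : ℤ) < triNorm u := by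
  rw [mem_sepOuterFence] at hu
  rw [lt_triNorm_iff_lin]
  omega

/-- **Gluing (one open arm).** A fenced open arm across `Λ_{64q} ∖ Λ_{n₁}`, the gluing event at
scale `q` and a fenced open arm across `Λ_{n₃} ∖ Λ_{512(q+1)}` together contain an open arm
across `Λ_{n₃} ∖ Λ_{n₁}`: the outer free space of the first arm is crossed horizontally by one of
the `33` thin boxes, which meets the first tube, which meets the long box, which meets the second
tube, which meets one of the `33` boxes at scale `512(q+1)`, which crosses the inner free space of
the second arm; the resulting open path from inside `Λ_{n₁}` to outside `Λ_{n₃}` is trimmed to an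
arm (`PathIn.exists_arm_of_triNorm_le`). (Nolin 2008, proof of Prop. 12 [arXiv Prop. 11]:
"once well-separated, the arms can easily be extended".) [cite: Nolin2008, §4.3 Prop. 12 (proof) (arXiv 0711.4948: Prop. 11)] -/
theorem sepOpenArm_inter_sepGlue_subset {q n₁ n₃ : ℕ} (hq : 1 ≤ q) (h₁₃ : n₁ ≤ n₃) :
    sepOpenArm n₁ (64 * q) ∩ sepGlue q ∩ sepOpenArm (512 * (q + 1)) n₃ ⊆ armEvent ![true] n₁ n₃ := by
  rintro ω ⟨⟨hO₁, hG⟩, hO₂⟩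
  obtain ⟨z, z', u, u', hz, hz', hVin, hVout, hJ⟩ := hO₁
  obtain ⟨Z, Z', U, U', hZ, hZ', hVin₂, hVout₂, hJ₂⟩ := hO₂
  simp only [sepGlue, mem_inter_iff, mem_iInter] at hG
  obtain ⟨⟨⟨⟨hH, hT₁⟩, hL⟩, hT₂⟩, hH'⟩ := hG
  -- integer divisions at the exactly divisible scales
  have e4 : 64 * q / 4 = 16 * q := by omega
  have e8 : 64 * q / 8 = 8 * q := by omega
  have e64 : 64 * q / 64 = q := by omega
  have E4 : 512 * (q + 1) / 4 = 128 * (q + 1) := by omega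
  have E8 : 512 * (q + 1) / 8 = 64 * (q + 1) := by omega
  have E64 : 512 * (q + 1) / 64 = 8 * (q + 1) := by omega
  -- the landing rows `t = z 1`, `t' = Z' 1`
  have hzL := hz
  rw [mem_sepLanding, e4] at hzL
  obtain ⟨hz0, hz1, hz2⟩ := hzL
  push_cast at hz0 hz1 hz2
  have hZL := hZ'
  rw [mem_sepLanding, E4] at hZL
  obtain ⟨hZ0, hZ1, hZ2⟩ := hZL
  push_cast at hZ0 hZ1 hZ2
  -- the slabs through the two free spaces
  obtain ⟨k, hk, hk1, hk2⟩ := exists_glueSlab (s := q) hq (t := z 1) (by linarith) (by linarith)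
  obtain ⟨k', hk', hk1', hk2'⟩ := exists_glueSlab (s := 8 * (q + 1)) (by omega) (t := Z' 1)
    (by push_cast; linarith) (by push_cast; linarith)
  -- the crossings
  obtain ⟨xH, yH, hxH, hyH, pH⟩ := hH k (Finset.mem_range.2 hk)
  obtain ⟨c₁, d₁, hc₁, hd₁, pT₁⟩ := hT₁
  obtain ⟨xL, yL, hxL, hyL, pL⟩ := hL
  obtain ⟨c₂, d₂, hc₂, hd₂, pT₂⟩ := hT₂
  obtain ⟨xH', yH', hxH', hyH', pH'⟩ := hH' k' (Finset.mem_range.2 hk')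
  -- the fence crossings
  rw [e64] at hVout
  obtain ⟨b₁, t₁, hb₁, ht₁, pF₁, pF₁'⟩ := hVout
  rw [E64] at hVin₂
  obtain ⟨b₂, t₂, hb₂, ht₂, pF₂, pF₂'⟩ := hVin₂
  have pV₁ : PathIn triGraph (sepOuterFence (64 * q) z ∩ ω) b₁ t₁ := pF₁.trans pF₁'
  have pV₂ : PathIn triGraph (sepInnerFence (512 * (q + 1)) Z' ∩ ω) b₂ t₂ := pF₂.trans pF₂'
  push_cast at hb₁ ht₁ hb₂ ht₂ hyH hyL hyH' hk1' hk2'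
  -- junction 1: the thin box `k` and the outer free space of the first arm
  have J₁ := PathIn.relay (L := 64 * (q : ℤ) + 1) (R := 72 * (q : ℤ)) (B := z 1 - q) (T := z 1 + q)
    (by linarith) (by linarith) pH (by rw [hxH]) (by rw [hyH]; linarith)
    (fun w hw _ _ => by rw [mem_triStrip] at hw; push_cast at hw; constructor <;> linarith)
    pV₁ (by rw [hb₁]) (by rw [ht₁])
    (fun w hw _ _ => by rw [mem_sepOuterFence, e8] at hw; push_cast at hw; constructor <;> linarith)
  -- junction 2: the thin box `k` and the first tube
  have hq' : (1 : ℤ) ≤ q := by exact_mod_cast hq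
  have J₂ := PathIn.relay (L := 72 * (q : ℤ) + 1) (R := 80 * (q : ℤ) + 1) (B := -(392 * ((q : ℤ) + 1)))
    (T := 0) (by linarith) (by linarith) pH (by rw [hxH]; linarith) (by rw [hyH]; linarith)
    (fun w hw _ _ => by rw [mem_triStrip] at hw; push_cast at hw; constructor <;> linarith)
    pT₁ (by rw [hc₁]) (by rw [hd₁]; push_cast; linarith)
    (fun w hw _ _ => by rw [mem_triStrip] at hw; push_cast at hw; constructor <;> linarith)
  -- junction 3: the long box and the first tube
  have J₃ := PathIn.relay (L := 72 * (q : ℤ) + 1) (R := 80 * (q : ℤ) + 1) (B := -(392 * ((q : ℤ) + 1)))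
    (T := 0) (by linarith) (by linarith) pL (by rw [hxL]) (by rw [hyL]; linarith)
    (fun w hw _ _ => by rw [mem_triStrip] at hw; push_cast at hw; constructor <;> linarith)
    pT₁ (by rw [hc₁]) (by rw [hd₁]; push_cast; linarith)
    (fun w hw _ _ => by rw [mem_triStrip] at hw; push_cast at hw; constructor <;> linarith)
  -- junction 4: the long box and the second tube
  have J₄ := PathIn.relay (L := 432 * ((q : ℤ) + 1) - 1) (R := 440 * ((q : ℤ) + 1) - 1)
    (B := -(392 * ((q : ℤ) + 1))) (T := 0) (by linarith) (by linarith) pL (by rw [hxL]; linarith)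
    (by rw [hyL]; linarith)
    (fun w hw _ _ => by rw [mem_triStrip] at hw; push_cast at hw; constructor <;> linarith)
    pT₂ (by rw [hc₂]) (by rw [hd₂]; push_cast; linarith)
    (fun w hw _ _ => by rw [mem_triStrip] at hw; push_cast at hw; constructor <;> linarith)
  -- junction 5: the box `k'` at scale `512(q+1)` and the second tube
  have J₅ := PathIn.relay (L := 432 * ((q : ℤ) + 1) - 1) (R := 440 * ((q : ℤ) + 1) - 1)
    (B := -(392 * ((q : ℤ) + 1))) (T := 0) (by linarith) (by linarith) pH' (by rw [hxH'])
    (by rw [hyH']; linarith)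
    (fun w hw _ _ => by rw [mem_triStrip] at hw; push_cast at hw; constructor <;> linarith)
    pT₂ (by rw [hc₂]) (by rw [hd₂]; push_cast; linarith)
    (fun w hw _ _ => by rw [mem_triStrip] at hw; push_cast at hw; constructor <;> linarith)
  -- junction 6: the box `k'` and the inner free space of the second arm
  have J₆ := PathIn.relay (L := 448 * ((q : ℤ) + 1)) (R := 512 * ((q : ℤ) + 1) - 1)
    (B := Z' 1 - 8 * ((q : ℤ) + 1)) (T := Z' 1 + 8 * ((q : ℤ) + 1)) (by linarith) (by linarith) pH'
    (by rw [hxH']; linarith) (by rw [hyH']; linarith)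
    (fun w hw _ _ => by rw [mem_triStrip] at hw; push_cast at hw; constructor <;> linarith)
    pV₂ (by rw [hb₂]) (by rw [ht₂])
    (fun w hw _ _ => by
      rw [mem_sepInnerFence, E8] at hw; push_cast at hw; constructor <;> linarith)
  -- the open path from the inner free space of the first arm to the outer one of the second
  have P : PathIn triGraph ω u U' :=
    (hJ.mono inter_subset_right) |>.trans (pF₁.symm.mono inter_subset_right)
      |>.trans (J₁.symm.mono inter_subset_right) |>.trans (J₂.mono inter_subset_right)
      |>.trans (J₃.symm.mono inter_subset_right) |>.trans (J₄.mono inter_subset_right)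
      |>.trans (J₅.symm.mono inter_subset_right) |>.trans (J₆.mono inter_subset_right)
      |>.trans (pF₂.mono inter_subset_right) |>.trans (hJ₂.mono inter_subset_right)
  -- trimming
  obtain ⟨b₀, t₀, -, -, pF₀, -⟩ := hVin
  obtain ⟨B₀, T₀, -, -, pG₀, -⟩ := hVout₂
  exact mem_armEvent_one_of_pathIn P (triNorm_le_of_mem_sepInnerFence hz' pF₀.right_mem.1)
    (lt_triNorm_of_mem_sepOuterFence pG₀.right_mem.1).le h₁₃

/-- **Gluing (two arms).** Well-separated two-arm events across `Λ_{64q} ∖ Λ_{n₁}` and across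
`Λ_{n₃} ∖ Λ_{512(q+1)}`, the gluing event at scale `q` (open, on the right) and its image under
`negFlip` (closed, on the left) together contain the polychromatic two-arm event across
`Λ_{n₃} ∖ Λ_{n₁}`: the open arm by `sepOpenArm_inter_sepGlue_subset`, the closed arm by the same
statement for `negFlip ω`; arms of different colours are disjoint. (Nolin 2008, proof of Prop. 12
[arXiv Prop. 11], quasi-multiplicativity item, `j = 2`, `σ = BW`.) [cite: Nolin2008, §4.3 Prop. 12 (proof) (arXiv 0711.4948: Prop. 11)] -/
theorem sepTwoArm_inter_sepGlue_subset {q n₁ n₃ : ℕ} (hq : 1 ≤ q) (h₁₃ : n₁ ≤ n₃) :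
    sepTwoArm n₁ (64 * q) ∩ (sepGlue q ∩ negFlip ⁻¹' sepGlue q) ∩ sepTwoArm (512 * (q + 1)) n₃ ⊆
      armEvent ![true, false] n₁ n₃ := by
  rintro ω ⟨⟨⟨hO₁, hC₁⟩, hG, hG'⟩, hO₂, hC₂⟩
  rw [armEvent_two_eq_inter]
  exact ⟨sepOpenArm_inter_sepGlue_subset hq h₁₃ ⟨⟨hO₁, hG⟩, hO₂⟩,
    mem_armEvent_false_of_negFlip h₁₃ (sepOpenArm_inter_sepGlue_subset hq h₁₃ ⟨⟨hC₁, hG'⟩, hC₂⟩)⟩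

/-! ### Supports of the fenced arm events and of the gluing event -/

/-- **The support of the fenced arm events.** The sites on which `sepOpenArm n N` depends lie in
`{n - n/8 ≤ |·|_𝕋 ≤ N + N/8}`, and those of them off the closed annulus `{n ≤ |·|_𝕋 ≤ N}` (free
spaces and attaching balls) lie in the right half-plane `{x₀ > 0}`. [cite: Nolin2008, §4.2, free spaces (arXiv 0711.4948: Def. 6)] -/
def sepSupportSet (n N : ℕ) : Set (Site 2) :=
  {v | (n : ℤ) - (n / 8 : ℕ) ≤ triNorm v ∧ triNorm v ≤ (N : ℤ) + (N / 8 : ℕ) ∧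
    ((triNorm v < n ∨ (N : ℤ) < triNorm v) → 0 < v 0)}

/-- Membership in `sepSupportSet`, unfolded. [cite: Nolin2008, §4.2, free spaces (arXiv 0711.4948: Def. 6)] -/
@[simp] theorem mem_sepSupportSet {n N : ℕ} {v : Site 2} :
    v ∈ sepSupportSet n N ↔ (n : ℤ) - (n / 8 : ℕ) ≤ triNorm v ∧ triNorm v ≤ (N : ℤ) + (N / 8 : ℕ) ∧
      ((triNorm v < n ∨ (N : ℤ) < triNorm v) → 0 < v 0) :=
  Iff.rfl

/-- An inner free space lies in the support set. [cite: Nolin2008, §4.2, free spaces on the internal boundary (arXiv 0711.4948: Def. 6–7)] -/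
theorem sepInnerFence_subset_sepSupportSet {n N : ℕ} (hnN : n ≤ N) {z' : Site 2}
    (hz' : z' ∈ sepLanding n) : sepInnerFence n z' ⊆ sepSupportSet n N := by
  intro v hv
  have hvn := triNorm_le_of_mem_sepInnerFence hz' hv
  rw [mem_sepInnerFence] at hv
  rw [mem_sepLanding] at hz'
  have h0 : v 0 ≤ triNorm v := le_triNorm_iff_lin.2 (Or.inl le_rfl)
  have hnN' : (n : ℤ) ≤ N := by exact_mod_cast hnN
  refine ⟨by omega, by omega, fun _ => by omega⟩

/-- An outer free space lies in the support set. [cite: Nolin2008, §4.2, free spaces (arXiv 0711.4948: Def. 6)] -/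
theorem sepOuterFence_subset_sepSupportSet {n N : ℕ} (hnN : n ≤ N) {z : Site 2}
    (hz : z ∈ sepLanding N) : sepOuterFence N z ⊆ sepSupportSet n N := by
  intro v hv
  rw [mem_sepOuterFence] at hv
  rw [mem_sepLanding] at hz
  have h0 : v 0 ≤ triNorm v := le_triNorm_iff_lin.2 (Or.inl le_rfl)
  have hnN' : (n : ℤ) ≤ N := by exact_mod_cast hnN
  refine ⟨by omega, ?_, fun _ => by omega⟩
  rw [triNorm_le_iff_lin]; omega

/-- The region of an arm and its attaching paths lies in the support set. [cite: Nolin2008, §4.2, free spaces on the internal boundary (arXiv 0711.4948: Def. 6–7)] -/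
theorem sepJoinRegion_subset_sepSupportSet {n N : ℕ} (hnN : n ≤ N) {z z' : Site 2}
    (hz : z ∈ sepLanding N) (hz' : z' ∈ sepLanding n) :
    sepJoinRegion n N z z' ⊆ sepSupportSet n N := by
  rw [mem_sepLanding] at hz hz'
  have hnN' : (n : ℤ) ≤ N := by exact_mod_cast hnN
  rintro v ((hv | hv) | hv)
  · rw [mem_triAnnulusSet] at hv
    exact ⟨by omega, by omega, fun h => by omega⟩
  · rw [mem_triOpenBall, triNorm_lt_iff_lin] at hv
    simp only [Pi.sub_apply] at hv
    have h0 : v 0 ≤ triNorm v := le_triNorm_iff_lin.2 (Or.inl le_rfl)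
    refine ⟨by omega, ?_, fun _ => by omega⟩
    rw [triNorm_le_iff_lin]; omega
  · rw [mem_triOpenBall, triNorm_lt_iff_lin] at hv
    simp only [Pi.sub_apply] at hv
    have h0 : v 0 ≤ triNorm v := le_triNorm_iff_lin.2 (Or.inl le_rfl)
    refine ⟨by omega, ?_, fun _ => by omega⟩
    rw [triNorm_le_iff_lin]; omega

/-- The sites of the `69` boxes of the gluing event. [cite: Nolin2008, §4.3 Prop. 12 (proof) (arXiv 0711.4948: Prop. 11)] -/
def sepGlueFinset (q : ℕ) : Finset (Site 2) :=
  (Finset.range 33).biUnion (fun k => triStripFinset (64 * (q : ℤ) + 1) ((-48 + (k : ℤ)) * q) (16 * q) q) ∪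
    triStripFinset (72 * (q : ℤ) + 1) (-(392 * ((q : ℤ) + 1))) (8 * q) (392 * (q + 1)) ∪
    triStripFinset (72 * (q : ℤ) + 1) (-(392 * ((q : ℤ) + 1))) (368 * q + 438) (392 * (q + 1)) ∪
    triStripFinset (432 * ((q : ℤ) + 1) - 1) (-(392 * ((q : ℤ) + 1))) (8 * (q + 1)) (392 * (q + 1)) ∪
    (Finset.range 33).biUnion (fun k => triStripFinset (432 * ((q : ℤ) + 1) - 1)
      ((-48 + (k : ℤ)) * (8 * ((q : ℤ) + 1))) (80 * (q + 1)) (8 * (q + 1)))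

/-- The boxes of the gluing event lie in the right half of the open annulus
`{64q < |·|_𝕋 < 512(q+1), x₀ > 0}` (`q ≥ 1`). [cite: Nolin2008, §4.3 Prop. 12 (proof) (arXiv 0711.4948: Prop. 11)] -/
theorem sepGlueFinset_subset {q : ℕ} (hq : 1 ≤ q) {v : Site 2} (hv : v ∈ sepGlueFinset q) :
    (64 * q : ℤ) < triNorm v ∧ triNorm v < 512 * ((q : ℤ) + 1) ∧ 0 < v 0 := by
  have hq' : (1 : ℤ) ≤ q := by exact_mod_cast hq
  have key : ∀ {a b : ℤ} {m n : ℕ}, v ∈ triStripFinset a b m n → 64 * (q : ℤ) < a → -(392 * ((q : ℤ) + 1)) ≤ b →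
      a + m < 512 * ((q : ℤ) + 1) → b + n ≤ 0 →
      (64 * q : ℤ) < triNorm v ∧ triNorm v < 512 * ((q : ℤ) + 1) ∧ 0 < v 0 := by
    intro a b m n hv ha hb ham hbn
    have hv' : v ∈ (↑(triStripFinset a b m n) : Set (Site 2)) := hv
    rw [coe_triStripFinset, mem_triStrip] at hv'
    refine ⟨lt_triNorm_iff_lin.2 (Or.inl (by omega)), ?_, by omega⟩
    rw [triNorm_lt_iff_lin]; omega
  simp only [sepGlueFinset, Finset.mem_union, Finset.mem_biUnion, Finset.mem_range] at hv
  rcases hv with (((⟨k, hk, hv⟩ | hv) | hv) | hv) | ⟨k, hk, hv⟩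
  · have hk' : (k : ℤ) ≤ 32 := by exact_mod_cast Nat.lt_succ_iff.1 hk
    refine key hv (by omega) ?_ (by push_cast; omega) ?_
    · nlinarith
    · nlinarith
  · exact key hv (by omega) le_rfl (by push_cast; omega) (by push_cast; omega)
  · exact key hv (by omega) le_rfl (by push_cast; omega) (by push_cast; omega)
  · exact key hv (by omega) le_rfl (by push_cast; omega) (by push_cast; omega)
  · have hk' : (k : ℤ) ≤ 32 := by exact_mod_cast Nat.lt_succ_iff.1 hk
    refine key hv (by omega) ?_ (by push_cast; omega) ?_
    · nlinarith
    · push_cast; nlinarith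

end Literature.Probability.Percolation
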